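import Literature.Barriers.SmoothPoincare4.ExoticContractibleProofs
import HarnessLib

/-!
# Barrier `ContractibleBarrierFour` (absolutely exotic compact contractible 4-manifolds): decomposition record

Barrier catalogue `Literature/Barriers/SmoothPoincare4/` (D-0021); theorems only.  The barrier
`Literature.Barriers.SmoothPoincare4.ContractibleBarrierFour := ¬ ContractibleRigidityFour`
(`ExoticContractible.lean`) is equivalent in the tree to Akbulut–Ruberman's Thm. B
(`akbulutRuberman2016_theoremB`; `contractibleRigidityFour_iff_not_theoremB`), and Thm. B is
proved there (`ExoticContractibleProofs.lean`, the printed one-paragraph proof of Comment. Math.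
Helv. 91 (2016), §3) from three EXISTING named facts, each a distinct published theorem — these
are the children of the decomposition recorded here:

1. `akbulut1991_notExtendsToDiffeomorph` — Akbulut 1991, Thm. 2 (= Akbulut–Yasui 2008,
   Lemma 2.8 (1), `n = 1`): the dot/zero-exchange involution of the boundary of the Mazur
   manifold extends to no self-diffeomorphism (gauge theory);
2. `akbulutRuberman2016_theoremA_contractible` — Akbulut–Ruberman 2016, Thm. A for a
   contractible `W` (invertible homology cobordisms to symmetry-free hyperbolic boundaries;
   itself split further in `ExoticContractibleTheoremAProofs.lean`);
3. `freedmanQuinn1990_homeomorph_extends_contractible` — Freedman–Quinn 1990, Prop. 11.1C /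
   Cor. 9.3C for the trivial group: boundary homeomorphisms of compact contractible 4-manifolds
   extend (the disc embedding theorem).

Assembly `contractibleBarrierFour_holds_of` = the landed
`contractibleBarrierFour_of_notExtendsToDiffeomorph` (cork from 1 + 3 by
`akbulut1991_mazurCork_of_notExtendsToDiffeomorph`, Thm. B from the cork, 2 and 3 by
`akbulutRuberman2016_theoremB_of_theoremA`).  No statement is introduced; none of the three
children is the barrier reworded (1 is a relative statement about one boundary involution, 2 a
construction theorem with a cork as HYPOTHESIS, 3 a purely topological extension theorem).

## References

* S. Akbulut, D. Ruberman, *Absolutely exotic compact 4-manifolds*, Comment. Math. Helv. 91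
  (2016) 1–19 (arXiv:1410.1461): Thm. A, Thm. B and its proof (§3). [AkbulutRuberman2016]
* S. Akbulut, *A fake compact contractible 4-manifold*, J. Differential Geom. 33 (1991), Thm. 2.
  [Akbulut1991Fake]
* M. H. Freedman, F. Quinn, *Topology of 4-manifolds* (1990), Cor. 9.3C, Prop. 11.1C.
  [FreedmanQuinn1990]
-/

noncomputable section

open scoped Manifold ContDiff

namespace Literature.Barriers.SmoothPoincare4

universe u

/-- **Assembly: the barrier `ContractibleBarrierFour` from the three printed leaves of
Akbulut–Ruberman's Thm. B** — Akbulut's non-extending boundary involution (1991, Thm. 2),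
Akbulut–Ruberman's Thm. A for contractible `W`, and Freedman–Quinn's extension of boundary
homeomorphisms over compact contractible 4-manifolds — by
`contractibleBarrierFour_of_notExtendsToDiffeomorph` (`ExoticContractibleProofs.lean`).
[cite: AkbulutRuberman2016, Thm. B and its proof (§3)] [cite: Akbulut1991Fake, Thm. 2] [cite: FreedmanQuinn1990, Prop. 11.1C (trivial group)] -/
theorem contractibleBarrierFour_holds_of :
    akbulut1991_notExtendsToDiffeomorph.{u} → akbulutRuberman2016_theoremA_contractible.{u} →
      freedmanQuinn1990_homeomorph_extends_contractible.{u} → ContractibleBarrierFour.{u} :=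
  fun hA hT hF => contractibleBarrierFour_of_notExtendsToDiffeomorph hA hT hF

/-- **Assembly for the named fact `akbulutRuberman2016_theoremB` itself from the same three
leaves** (the barrier's equivalent form). [cite: AkbulutRuberman2016, proof of Thm. B (§3)] -/
theorem akbulutRuberman2016_theoremB_holds_of :
    akbulut1991_notExtendsToDiffeomorph.{u} → akbulutRuberman2016_theoremA_contractible.{u} →
      freedmanQuinn1990_homeomorph_extends_contractible.{u} → akbulutRuberman2016_theoremB.{u} :=
  fun hA hT hF => akbulutRuberman2016_theoremB_of_theoremA
    (akbulut1991_mazurCork_of_notExtendsToDiffeomorph hA hF) hT hF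

end Literature.Barriers.SmoothPoincare4
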